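import Literature.MathematicalPhysics.QuantumLattice.WilsonCellSchur
import Literature.MathematicalPhysics.QuantumLattice.WilsonPositivityDomain

/-!
# Crux `CoerciveSea` (stmt-QuantumFields-13901), negative side, 2/4 — coercivity of compressed
# Wilson–Dirac matrices; near-singular separators need `μ < |τ|`

Support file of the standing disprover of the hinge crux `CoerciveSea` (route `NestedDissectionSea`).
Zero-extension / compression bookkeeping for principal submatrices (`Matrix.toSquareBlockProp`) of
the Wilson–Dirac matrix, the quadratic-form bound `|⟨v, K_c v⟩| ≤ 4‖v‖²` for the compressed hopping
sum (`‖K‖ ≤ 4`, tree `l2_opNorm_wilsonHop_le`), hence COERCIVITY `Re⟨v, D_c v⟩ ≥ μ‖v‖²` of every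
Dirichlet cell (`re_inner_compressed_ge`) and the consequence for the crux vocabulary
`HasSingularSeparator U μ s τ → μ < |τ|` (`hasSingularSeparator_mass_lt`): the `μ ≥ 0` shadow of route
item `KineticEdge` (b) — clause (i) of `CoerciveSea` is EMPTY at valence masses `≥ 1/2`.
Standard material. [folklore]
-/

noncomputable section

open scoped BigOperators ComplexConjugate Kronecker
open MeasureTheory Filter Matrix
open Literature.MathematicalPhysics.QuantumLattice Literature.MathematicalPhysics.QuantumFieldTheory
  Literature.Probability.LatticeModels

namespace Summit.QuantumFields.QCD.Theorems.CoerciveSeaNegative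

/-! ## Part B — cell level: compression, coercivity, near-singular separators, real and positive Dirichlet determinants -/


/-! ### B.0 generic: zero extension (`Function.extend Subtype.val v 0`) and compression -/

section Generic

variable {n : Type*} [Fintype n] (p : n → Prop) [DecidablePred p]

omit [Fintype n] [DecidablePred p] in
/-- The zero extension `Function.extend Subtype.val v 0` restricts back to `v`. [folklore] -/
theorem extend_val_apply (v : {a // p a} → ℂ) (a : {a // p a}) :
    Function.extend Subtype.val v 0 (a : n) = v a :=
  Subtype.val_injective.extend_apply _ _ _

omit [Fintype n] [DecidablePred p] in
/-- The zero extension vanishes off the subtype. [folklore] -/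
theorem extend_val_of_not (v : {a // p a} → ℂ) {b : n} (hb : ¬ p b) :
    Function.extend Subtype.val v 0 b = 0 := by
  rw [Function.extend_apply']
  · rfl
  · rintro ⟨a, rfl⟩; exact hb a.2

/-- Sums of functions vanishing at `0` over the zero extension reduce to the subtype. [folklore] -/
theorem sum_extend_val {M : Type*} [AddCommMonoid M] (v : {a // p a} → ℂ) (F : n → ℂ → M)
    (hF : ∀ b, F b 0 = 0) :
    ∑ b, F b (Function.extend Subtype.val v 0 b) = ∑ a : {a // p a}, F a (v a) := by
  rw [← Fintype.sum_subtype_add_sum_subtype p (fun b => F b (Function.extend Subtype.val v 0 b))]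
  have h0 : ∑ a : {a // ¬ p a}, F a (Function.extend Subtype.val v 0 a) = 0 :=
    Finset.sum_eq_zero fun a _ => by rw [extend_val_of_not p v a.2, hF]
  simp only [extend_val_apply, h0, add_zero]

/-- The compressed matrix acts on `v` as the full matrix acts on the zero extension. [folklore] -/
theorem toSquareBlockProp_mulVec (M : Matrix n n ℂ) (v : {a // p a} → ℂ) (i : {a // p a}) :
    (M.toSquareBlockProp p *ᵥ v) i = (M *ᵥ Function.extend Subtype.val v 0) i := by
  simp only [Matrix.mulVec, dotProduct, toSquareBlockProp_def, Matrix.of_apply]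
  rw [sum_extend_val p v (fun b z => M i b * z) (fun b => mul_zero _)]

omit [Fintype n] [DecidablePred p] in
/-- Compression is linear and unital: `(c•1 − K)_c = c•1 − K_c`. [folklore] -/
theorem toSquareBlockProp_smul_one_sub [DecidableEq n] (c : ℂ) (K : Matrix n n ℂ) :
    (c • (1 : Matrix n n ℂ) - K).toSquareBlockProp p = c • 1 - K.toSquareBlockProp p := by
  ext i j
  simp only [toSquareBlockProp_def, Matrix.of_apply, Matrix.sub_apply, Matrix.smul_apply,
    Matrix.one_apply, Subtype.val_inj]

end Generic

/-! ### B.1 coercivity of the hopping form, full index and compressed -/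

section Hop

variable {L N : ℕ} [NeZero L] {G : Type*} [Group G] (ρ : G →* Matrix (Fin N) (Fin N) ℂ)

open scoped Matrix.Norms.L2Operator in
/-- `|⟨ψ, K ψ⟩| ≤ 4 ‖ψ‖²` for the Wilson hopping sum `K = Σ_μ W_μ` (`‖K‖ ≤ 4`). [folklore] -/
theorem norm_inner_hop_le (hρ : ∀ g, ρ g ∈ Matrix.unitaryGroup (Fin N) ℂ) (U : GaugeConfig 4 L G)
    (ψ : TorusSite 4 L × Fin N × Fin 4 → ℂ) :
    ‖∑ i, conj (ψ i) * ((∑ μ, wilsonHop ρ U μ) *ᵥ ψ) i‖ ≤ 4 * ∑ i, ‖ψ i‖ ^ 2 := by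
  set K := ∑ μ, wilsonHop ρ U μ with hKdef
  have hK : ‖K‖ ≤ 4 := l2_opNorm_sum_wilsonHop_le ρ hρ U
  have h1 : ∑ i, ‖(K *ᵥ ψ) i‖ ^ 2 ≤ ‖K‖ ^ 2 * ∑ i, ‖ψ i‖ ^ 2 := sum_norm_sq_mulVec_le K ψ
  have hn : 0 ≤ ∑ i, ‖ψ i‖ ^ 2 := Finset.sum_nonneg fun i _ => by positivity
  have h2 : ∑ i, ‖(K *ᵥ ψ) i‖ ^ 2 ≤ 16 * ∑ i, ‖ψ i‖ ^ 2 := h1.trans (by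
    apply mul_le_mul_of_nonneg_right _ hn
    nlinarith [norm_nonneg K])
  have hA : 0 ≤ ∑ i, ‖ψ i‖ * ‖(K *ᵥ ψ) i‖ := Finset.sum_nonneg fun i _ => by positivity
  have hcs := Finset.sum_mul_sq_le_sq_mul_sq Finset.univ (fun i => ‖ψ i‖) (fun i => ‖(K *ᵥ ψ) i‖)
  have h3 : (∑ i, ‖ψ i‖ * ‖(K *ᵥ ψ) i‖) ^ 2 ≤ (4 * ∑ i, ‖ψ i‖ ^ 2) ^ 2 :=
    calc (∑ i, ‖ψ i‖ * ‖(K *ᵥ ψ) i‖) ^ 2 ≤ (∑ i, ‖ψ i‖ ^ 2) * ∑ i, ‖(K *ᵥ ψ) i‖ ^ 2 := hcs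
      _ ≤ (∑ i, ‖ψ i‖ ^ 2) * (16 * ∑ i, ‖ψ i‖ ^ 2) := by gcongr
      _ = (4 * ∑ i, ‖ψ i‖ ^ 2) ^ 2 := by ring
  have h4 : ∑ i, ‖ψ i‖ * ‖(K *ᵥ ψ) i‖ ≤ 4 * ∑ i, ‖ψ i‖ ^ 2 :=
    (pow_le_pow_iff_left₀ hA (by positivity) two_ne_zero).mp h3
  calc ‖∑ i, conj (ψ i) * (K *ᵥ ψ) i‖ ≤ ∑ i, ‖conj (ψ i) * (K *ᵥ ψ) i‖ := norm_sum_le _ _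
    _ = ∑ i, ‖ψ i‖ * ‖(K *ᵥ ψ) i‖ := by simp
    _ ≤ 4 * ∑ i, ‖ψ i‖ ^ 2 := h4

/-- The same bound for the hopping sum COMPRESSED to any index subset (zero extension). [folklore] -/
theorem norm_inner_hop_compressed_le (hρ : ∀ g, ρ g ∈ Matrix.unitaryGroup (Fin N) ℂ)
    (U : GaugeConfig 4 L G) (p : TorusSite 4 L × Fin N × Fin 4 → Prop) [DecidablePred p]
    (v : {a // p a} → ℂ) :
    ‖∑ a, conj (v a) * (((∑ μ, wilsonHop ρ U μ).toSquareBlockProp p) *ᵥ v) a‖ ≤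
      4 * ∑ a, ‖v a‖ ^ 2 := by
  have h := norm_inner_hop_le ρ hρ U (Function.extend Subtype.val v 0)
  rw [sum_extend_val p v (fun _ z => ‖z‖ ^ 2) (by simp),
    sum_extend_val p v (fun b z => conj z *
      ((∑ μ, wilsonHop ρ U μ) *ᵥ Function.extend Subtype.val v 0) b) (by simp)] at h
  simpa only [toSquareBlockProp_mulVec] using h

/-- **Coercivity of compressed Wilson–Dirac matrices**: for every index subset `p`, every vector
`v` on it and every bare mass `μ`, `Re ⟨v, D_c v⟩ ≥ μ ‖v‖²` (`D_c = (μ+4)·1 − K_c`, `‖K‖ ≤ 4`).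
This is the `μ ≥ 0` shadow of route item `KineticEdge`. [folklore] -/
theorem re_inner_compressed_ge (hρ : ∀ g, ρ g ∈ Matrix.unitaryGroup (Fin N) ℂ)
    (U : GaugeConfig 4 L G) (μ : ℝ) (p : TorusSite 4 L × Fin N × Fin 4 → Prop) [DecidablePred p]
    (v : {a // p a} → ℂ) :
    μ * ∑ a, ‖v a‖ ^ 2 ≤
      (∑ a, conj (v a) * (((wilsonDirac ρ U μ 1).toSquareBlockProp p) *ᵥ v) a).re := by
  rw [wilsonDirac_eq_sub_sum_wilsonHop ρ hρ, toSquareBlockProp_smul_one_sub, Matrix.sub_mulVec,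
    Matrix.smul_mulVec, Matrix.one_mulVec]
  simp only [Pi.sub_apply, Pi.smul_apply, smul_eq_mul, mul_sub, Finset.sum_sub_distrib,
    Complex.sub_re]
  have h1 : (∑ a, conj (v a) * (((μ + 4 : ℝ) : ℂ) * v a)).re = (μ + 4) * ∑ a, ‖v a‖ ^ 2 := by
    have : ∑ a, conj (v a) * (((μ + 4 : ℝ) : ℂ) * v a) = (((μ + 4) * ∑ a, ‖v a‖ ^ 2 : ℝ) : ℂ) := by
      rw [Complex.ofReal_mul, Complex.ofReal_sum, Finset.mul_sum]
      refine Finset.sum_congr rfl fun a _ => ?_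
      rw [mul_left_comm, Complex.conj_mul' (v a)]
      push_cast; ring
    rw [this, Complex.ofReal_re]
  have h2 := (Complex.re_le_norm _).trans (norm_inner_hop_compressed_le ρ hρ U p v)
  rw [h1]
  linarith

end Hop

/-! ### B.2 near-singular separators need `μ < τ` -/

/-- **A `τ`-singular separator forces `μ < |τ|`.** If the corner-`0` box of sides `s` has a
`τ`-singular separator at bare mass `μ` (`HasSingularSeparator U μ s τ`: a vector `w`, harmonic on
the children interiors, non-zero on the separator, with separator residual `< τ² ×` separator
mass), then `μ < |τ|`: by harmonicity the separator residual is the FULL residual `‖D_c w‖²`, by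
coercivity `μ‖w‖² ≤ Re⟨w, D_c w⟩ ≤ ‖w‖ ‖D_c w‖ < |τ| ‖w‖ ‖w_Σ‖ ≤ |τ| ‖w‖²`. In clause (i) of
`CoerciveSea` the level is `τ = t/s₀ ≤ 1/2`, so at valence masses `μ ≥ 1/2` the event is EMPTY
for every gauge field — the clause is vacuous in the heavy junk corner. [folklore] -/
theorem hasSingularSeparator_mass_lt {Nt : ℕ} [NeZero Nt] {U : GaugeConfig 4 Nt (Matrix.specialUnitaryGroup (Fin 3) ℂ)} {μ τ : ℝ}
    {s : Fin 4 → ℕ} (h : HasSingularSeparator U μ s τ) : μ < |τ| := by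
  obtain ⟨w, ⟨p₀, -, hw₀⟩, hharm, hres⟩ := h
  set Dc := wilsonCell U μ 0 s with hDc
  set n2 := ∑ p, ‖w p‖ ^ 2 with hn2
  have hn2_pos : 0 < n2 := by
    have hw₀' : 0 < ‖w p₀‖ := norm_pos_iff.mpr hw₀
    exact Finset.sum_pos' (fun p _ => by positivity) ⟨p₀, Finset.mem_univ _, by positivity⟩
  have hRfull : ∑ p, ‖(Dc *ᵥ w) p‖ ^ 2 =
      ∑ p, (if childrenInterior s p then 0 else ‖(Dc *ᵥ w) p‖ ^ 2) := by
    refine Finset.sum_congr rfl fun p _ => ?_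
    split_ifs with hp
    · rw [hharm p hp]; simp
    · rfl
  have hsep_le : ∑ p, (if childrenInterior s p then 0 else ‖w p‖ ^ 2) ≤ n2 :=
    Finset.sum_le_sum fun p _ => by
      split_ifs
      · positivity
      · exact le_rfl
  have hR2 : ∑ p, ‖(Dc *ᵥ w) p‖ ^ 2 < τ ^ 2 * n2 := by
    rw [hRfull]; exact hres.trans_le (mul_le_mul_of_nonneg_left hsep_le (sq_nonneg τ))
  have hco := re_inner_compressed_ge (fundamentalRep (Fin 3)) fundamentalRep_mem_unitaryGroup U μ
    (wilsonBox 0 s) w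
  change μ * n2 ≤ (∑ p, conj (w p) * (Dc *ᵥ w) p).re at hco
  set A := ∑ p, ‖w p‖ * ‖(Dc *ᵥ w) p‖ with hA
  have hA1 : (∑ p, conj (w p) * (Dc *ᵥ w) p).re ≤ A := by
    refine (Complex.re_le_norm _).trans ((norm_sum_le _ _).trans (le_of_eq ?_))
    simp [A]
  have hA2 : A ^ 2 ≤ n2 * ∑ p, ‖(Dc *ᵥ w) p‖ ^ 2 := Finset.sum_mul_sq_le_sq_mul_sq _ _ _
  by_contra hle
  push Not at hle
  have hμ0 : 0 ≤ μ := (abs_nonneg τ).trans hle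
  have h1 : μ * n2 ≤ A := hco.trans hA1
  have h2 : (μ * n2) ^ 2 ≤ A ^ 2 := pow_le_pow_left₀ (by positivity) h1 2
  have h3 : A ^ 2 < n2 * (τ ^ 2 * n2) := hA2.trans_lt (mul_lt_mul_of_pos_left hR2 hn2_pos)
  have h4 : τ ^ 2 ≤ μ ^ 2 := by
    calc τ ^ 2 = |τ| ^ 2 := (sq_abs τ).symm
      _ ≤ μ ^ 2 := pow_le_pow_left₀ (abs_nonneg τ) hle 2
  have h5 : n2 * (τ ^ 2 * n2) ≤ (μ * n2) ^ 2 := by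
    have := mul_le_mul_of_nonneg_right h4 (sq_nonneg n2)
    nlinarith
  linarith


end Summit.QuantumFields.QCD.Theorems.CoerciveSeaNegative

end
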